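import Summits.Ventures.PackingBounds.ThreePointCert.CheckResidualZ

/-!
# Three-point certificate checker: Bachoc–Vallentin's full multiplier set (`sym2`)

Framing: lottery ticket; floor = certified bounds/negative ranges. Venture `PackingBounds`
(cell `pub-packcert`), three-point SDP family.

`ThreePointCert.Check` validates identity `(ii')` in the symmetric SOS form of Machado–de Oliveira
Filho (multipliers `1, s₁, s₂, s₃, s₄` with `S₃`-invariant sums of squares; the cell's mode `sym`).
Bachoc–Vallentin's original programme (J. AMS 21 (2008), (10) in the proof of Theorem 4.2) is
slightly stronger: the multiplier `g(u) = (u+1)(s-u)` carries a sum of squares `q₁(u,v,t)` that is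
only invariant under `v ↔ t`, and the term entering `(ii')` is the coset sum
`g(u) q₁(u,v,t) + g(v) q₁(v,u,t) + g(t) q₁(t,v,u)` (the cell's mode `sym2` = "BV strength"; all the
Tammes certificates, the `s = 1/4, 1/5` certificates and `κ(9) ≤ 366` are of this kind).

This file adds exactly that right-hand side (`rhsII3S2`), its trie-free residual check `checkII3S2Z`
(same shape as `checkII3Z` of `CheckResidualZ`), and the corresponding soundness theorems
`FII3S2_of_checkZ` and `card_le_of_cert3S2Z` — copies of `FII3_of_checkZ` / `card_le_of_cert3Z`
in which only the nonnegativity of the right-hand side on the domain changes: each of the three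
coset terms is `g(x) · E₁(…) ≥ 0` because `g ≥ 0` on `[-1, s]` and a validated Gram expansion is
nonnegative on the whole unit box (so also at permuted arguments). Everything else — the data format
`Cert3`/`CertPolys3`, the expansion-validity predicate `PolysOK3` (seven Gram blocks), `checkI3Z`,
`checkSide3`, `checkBound3` — is reused unchanged, so the existing emitters apply with a one-line
change of the final theorem.

## References
* C. Bachoc, F. Vallentin, New upper bounds for kissing numbers from semidefinite programming,
  J. Amer. Math. Soc. 21 (2008) 909–924, Theorem 4.2 and (10). [`BachocVallentin2007`]
* F. C. Machado, F. M. de Oliveira Filho, Exp. Math. 27 (2018), Lemma 3.1. [`MachadoDeOliveiraFilho2018`]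
-/

noncomputable section

open Finset
open scoped RealInnerProductSpace

namespace Summit.Ventures.PackingBounds.ThreePointCert

open Literature.Geometry.DiscreteGeometry Literature.Geometry.DiscreteGeometry.PolyCert
open Literature.Geometry.DiscreteGeometry.PolyCert.SPoly
open Literature.Analysis.SpecialFunctions

/-- The term `g_q(u) · E₁(u,v,t)` (`g_q(u) = (u+1)(p - qu) = q·g(u)`). -/
def gE1 (c : Cert3) (P : CertPolys3) : SPoly := mulN (gqU c.p c.q) P.E1

/-- Sum-of-squares side of `(ii')` with Bachoc–Vallentin's multiplier set (mode `sym2`):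
`E₀ + [g_q(u)E₁(u,v,t) + g_q(v)E₁(v,u,t) + g_q(t)E₁(t,v,u)] + m₂E₂ + m₃E₃ + s₄E₄`
(`E₁` a Gram expansion invariant under `v ↔ t`; `m₂ = q²s₂`, `m₃ = q³s₃` as in `rhsII3`). -/
def rhsII3S2 (c : Cert3) (P : CertPolys3) : SPoly :=
  mergeAll [P.E0, gE1 c P, permBAC (gE1 c P), permCBA (gE1 c P),
    mulN (m2P c.p c.q) P.E2, mulN (m3P c.p c.q) P.E3, mulN p4 P.E4]

/-- Trie-free check of `(ii')` in mode `sym2`: `absSum` of the merged residual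
`target - rhs - c₀` is `≤ c₀`. -/
def checkII3S2Z (c : Cert3) (P : CertPolys3) : Bool :=
  decide (absSum (mergeAll [targetII3 c P, neg (rhsII3S2 c P), neg (C (c.c0 : ℤ))]) ≤ c.c0)

/-- `eval (gE1 c P) = (u+1)(p - qu) · E₁(u,v,t)`. -/
@[simp] theorem eval_gE1 (c : Cert3) (P : CertPolys3) (u v t : ℝ) :
    eval (gE1 c P) u v t = (u + 1) * ((c.p : ℝ) - c.q * u) * eval P.E1 u v t := by
  simp [gE1]

/-- The `sym2` right-hand side is nonnegative on the domain `D'` when the five Gram expansions are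
valid. -/
theorem rhsII3S2_nonneg (c : Cert3) (P : CertPolys3) {g0 g1 g2 g3 g4 q0 q1 : GramBlk}
    (hP : PolysOK3 c P g0 g1 g2 g3 g4 q0 q1) (hq : 0 < c.q) (hpq : c.p ≤ (c.q : ℤ)) (u v t : ℝ)
    (hu : -1 ≤ u) (hu' : u ≤ (c.p : ℝ) / c.q) (hv : -1 ≤ v) (hv' : v ≤ (c.p : ℝ) / c.q)
    (ht : -1 ≤ t) (ht' : t ≤ (c.p : ℝ) / c.q)
    (hp : 0 ≤ 1 + 2 * u * v * t - u ^ 2 - v ^ 2 - t ^ 2) :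
    0 ≤ eval (rhsII3S2 c P) u v t := by
  have hu1 := abs_le_one_of_box c.p c.q hq hpq u hu hu'
  have hv1 := abs_le_one_of_box c.p c.q hq hpq v hv hv'
  have ht1 := abs_le_one_of_box c.p c.q hq hpq t ht ht'
  have gu := gq_nonneg c.p c.q u hu (qmul_le_of_box c.p c.q hq u hu')
  have gv := gq_nonneg c.p c.q v hv (qmul_le_of_box c.p c.q hq v hv')
  have gt := gq_nonneg c.p c.q t ht (qmul_le_of_box c.p c.q hq t ht')
  have e0 := eval_nonneg_of_rvalid g0 P.E0 hP.h0 u v t hu1 hv1 ht1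
  have e1 := eval_nonneg_of_rvalid g1 P.E1 hP.h1 u v t hu1 hv1 ht1
  have e1' := eval_nonneg_of_rvalid g1 P.E1 hP.h1 v u t hv1 hu1 ht1
  have e1'' := eval_nonneg_of_rvalid g1 P.E1 hP.h1 t v u ht1 hv1 hu1
  have e2 := eval_nonneg_of_rvalid g2 P.E2 hP.h2 u v t hu1 hv1 ht1
  have e3 := eval_nonneg_of_rvalid g3 P.E3 hP.h3 u v t hu1 hv1 ht1
  have e4 := eval_nonneg_of_rvalid g4 P.E4 hP.h4 u v t hu1 hv1 ht1
  rw [rhsII3S2, eval_mergeAll]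
  simp only [List.map_cons, List.map_nil, List.sum_cons, List.sum_nil, add_zero, eval_mulN,
    eval_permBAC, eval_permCBA, eval_gE1, eval_m2P, eval_m3P, eval_p4]
  generalize eval P.E0 u v t = r0 at *
  generalize eval P.E1 u v t = r1 at *
  generalize eval P.E1 v u t = r1' at *
  generalize eval P.E1 t v u = r1'' at *
  generalize eval P.E2 u v t = r2 at *
  generalize eval P.E3 u v t = r3 at *
  generalize eval P.E4 u v t = r4 at *
  generalize (u + 1) * ((c.p : ℝ) - c.q * u) = a1 at *
  generalize (v + 1) * ((c.p : ℝ) - c.q * v) = a2 at *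
  generalize (t + 1) * ((c.p : ℝ) - c.q * t) = a3 at *
  have m12 := mul_nonneg gu gv
  have m13 := mul_nonneg gu gt
  have m23 := mul_nonneg gv gt
  have m123 := mul_nonneg gu (mul_nonneg gv gt)
  nlinarith [mul_nonneg gu e1, mul_nonneg gv e1', mul_nonneg gt e1'', mul_nonneg m12 e2,
    mul_nonneg m13 e2, mul_nonneg m23 e2, mul_nonneg m123 e3, mul_nonneg hp e4]

set_option maxHeartbeats 4000000 in
/-- Soundness of `(ii')` in mode `sym2` from the trie-free check: on `D'`, `F ≤ -b₂₂`
(in units: `FvalG/D² ≤ -B22/(D²W)`). -/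
theorem FII3S2_of_checkZ (c : Cert3) (P : CertPolys3) {g0 g1 g2 g3 g4 q0 q1 : GramBlk}
    (hP : PolysOK3 c P g0 g1 g2 g3 g4 q0 q1) (h : checkII3S2Z c P = true) (hs : checkSide3 c = true)
    (u v t : ℝ)
    (hu : -1 ≤ u) (hu' : u ≤ (c.p : ℝ) / c.q) (hv : -1 ≤ v) (hv' : v ≤ (c.p : ℝ) / c.q)
    (ht : -1 ≤ t) (ht' : t ≤ (c.p : ℝ) / c.q)
    (hp : 0 ≤ 1 + 2 * u * v * t - u ^ 2 - v ^ 2 - t ^ 2) :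
    FvalG c.n c.F u v t / 2 ^ (2 * c.S) ≤ -((c.B22 : ℝ) / c.DDW) := by
  obtain ⟨hn, hq, hpq, _, hAlen, hFk, _⟩ := side_of_check c hs
  have hu1 := abs_le_one_of_box c.p c.q hq hpq u hu hu'
  have hv1 := abs_le_one_of_box c.p c.q hq hpq v hv hv'
  have ht1 := abs_le_one_of_box c.p c.q hq hpq t ht ht'
  have hle : absSum (mergeAll [targetII3 c P, neg (rhsII3S2 c P), neg (C (c.c0 : ℤ))]) ≤ c.c0 := by
    unfold checkII3S2Z at h; exact of_decide_eq_true h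
  have hres := (abs_eval_le _ hu1 hv1 ht1).trans (Nat.cast_le.2 hle)
  clear hle h
  rw [eval_mergeAll] at hres
  simp only [List.map_cons, List.map_nil, List.sum_cons, List.sum_nil, add_zero, eval_neg, eval_C,
    Int.cast_natCast] at hres
  have hrhs : 0 ≤ eval (rhsII3S2 c P) u v t :=
    rhsII3S2_nonneg c P hP hq hpq u v t hu hu' hv hv' ht ht' hp
  generalize hR : eval (rhsII3S2 c P) u v t = R at hres hrhs
  have htgt : 0 ≤ eval (targetII3 c P) u v t := by
    have h1 := (abs_le.1 hres).1
    linarith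
  rw [targetII3, eval_neg, eval_append, eval_C, hP.hF u v t hu1 hv1 ht1,
    eval_FPolyG c.n c.d c.F hFk] at htgt
  push_cast at htgt
  have hW : (0 : ℝ) < Wfac c.d := by exact_mod_cast Wfac_pos c.d
  have hD : (0 : ℝ) < 2 ^ (2 * c.S) := pow_pos (by norm_num) _
  have hDDW : (c.DDW : ℝ) = 2 ^ (2 * c.S) * (Wfac c.d : ℝ) := by simp [Cert3.DDW]
  have key : FvalG c.n c.F u v t * (Wfac c.d : ℝ) ≤ -(c.B22 : ℝ) := by linarith
  rw [hDDW, div_le_iff₀ hD]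
  have e : -((c.B22 : ℝ) / (2 ^ (2 * c.S) * Wfac c.d)) * 2 ^ (2 * c.S) = -(c.B22 : ℝ) / Wfac c.d := by
    field_simp
  rw [e, le_div_iff₀ hW]
  exact key

/-- **The bound from a checked certificate in Bachoc–Vallentin's own multiplier set** (mode
`sym2`; Theorem 4.2, any `n ≥ 4`, angle `s = p/q`): if the side conditions, the expansions, the
trie-free checks `checkI3Z` / `checkII3S2Z` and the numerical bound all pass, every finite set of
unit vectors of `ℝⁿ` with pairwise inner products `≤ p/q` has at most `N` elements. -/
theorem card_le_of_cert3S2Z (c : Cert3) (P : CertPolys3) {g0 g1 g2 g3 g4 q0 q1 : GramBlk}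
    (hP : PolysOK3 c P g0 g1 g2 g3 g4 q0 q1) (hI : checkI3Z c P = true)
    (hII : checkII3S2Z c P = true) (hs : checkSide3 c = true) (hb : checkBound3 c P = true)
    (C : Finset (EuclideanSpace ℝ (Fin c.n))) (hC : ∀ x ∈ C, ‖x‖ = 1)
    (hcode : ∀ x ∈ C, ∀ y ∈ C, x ≠ y → inner ℝ x y ≤ (c.p : ℝ) / c.q) : C.card ≤ c.N := by
  obtain ⟨hn, hq, hpq, _, hAlen, hFk, _⟩ := side_of_check c hs
  have hbd := bound3_of_check c P hP.hF hs hb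
  have hD : (0 : ℝ) < 2 ^ (2 * c.S) := pow_pos (by norm_num) _
  have hA : 0 ≤ BachocVallentin.pairSum C (fun u => AvalG c.n c.A u / 2 ^ (2 * c.S)) := by
    have h0 := pairSum_AvalG_nonneg (by omega : 3 ≤ c.n) c.A C hC
    unfold BachocVallentin.pairSum at h0 ⊢
    have e : (∑ x ∈ C, ∑ y ∈ C, AvalG c.n c.A (inner ℝ x y) / 2 ^ (2 * c.S)) =
        (∑ x ∈ C, ∑ y ∈ C, AvalG c.n c.A (inner ℝ x y)) / 2 ^ (2 * c.S) := by
      rw [Finset.sum_div]; refine Finset.sum_congr rfl fun x _ => ?_; rw [Finset.sum_div]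
    rw [e]; exact div_nonneg h0 hD.le
  have hF : 0 ≤ BachocVallentin.tripleSum C (fun u v t => FvalG c.n c.F u v t / 2 ^ (2 * c.S)) := by
    have h0 := tripleSum_FvalG_nonneg hn c.F C hC
    unfold BachocVallentin.tripleSum at h0 ⊢
    have e : (∑ x ∈ C, ∑ y ∈ C, ∑ z ∈ C,
        FvalG c.n c.F (inner ℝ x y) (inner ℝ x z) (inner ℝ y z) / 2 ^ (2 * c.S))
        = (∑ x ∈ C, ∑ y ∈ C, ∑ z ∈ C,
          FvalG c.n c.F (inner ℝ x y) (inner ℝ x z) (inner ℝ y z)) / 2 ^ (2 * c.S) := by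
      rw [Finset.sum_div]; refine Finset.sum_congr rfl fun x _ => ?_
      rw [Finset.sum_div]; refine Finset.sum_congr rfl fun y _ => ?_
      rw [Finset.sum_div]
    rw [e]; exact div_nonneg h0 hD.le
  have h := BachocVallentin.card_le_of_threePoint ((c.p : ℝ) / c.q) C hC hcode
    (fun u => AvalG c.n c.A u / 2 ^ (2 * c.S)) (fun u v t => FvalG c.n c.F u v t / 2 ^ (2 * c.S))
    ((c.B11 : ℝ) / c.DDW) ((c.B12 : ℝ) / c.DDW) ((c.B22 : ℝ) / c.DDW) hA hF
    (fun u v t => by rw [FvalG_swap12])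
    (fun u v t => by rw [FvalG_swap23])
    (bquad3_nonneg_of_check c hs)
    (fun u hu hu' => AF3_of_checkZ c P hP hI hs u hu hu')
    (fun u v t hu hu' hv hv' ht ht' hp =>
      FII3S2_of_checkZ c P hP hII hs u v t hu hu' hv hv' ht ht' hp)
    hbd.2
  have hlt : (C.card : ℝ) < (c.N : ℝ) + 1 := lt_of_le_of_lt h hbd.1
  have hlt' : C.card < c.N + 1 := by exact_mod_cast hlt
  omega


/-! ### Trie-based check (complete on unsorted term lists)

`checkII3S2Z` above (like `checkI3Z`/`checkII3Z` of `CheckResidualZ`) is sound but only *complete*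
when the merged term list has all equal monomials combined; `mergeAll`/`mergeAdd` combine ADJACENT
equal monomials of sorted inputs only, and `targetII3`/`targetI3` are concatenations (`C b ++ …`,
`substUU1 …`) that are not sorted — so on real certificates the `Z` checks evaluate to `false`
(observed on the cell's `n = 4, d = 7` certificate). The production check is therefore the
trie-based one below (`residualBound`, as in `checkII3`), which accumulates every term. -/

/-- Check of `(ii')` in mode `sym2` with the trie-based residual bound (as `checkII3`). -/
def checkII3S2 (c : Cert3) (P : CertPolys3) : Bool :=
  residualBound (mergeAll [targetII3 c P, neg (rhsII3S2 c P), neg (C (c.c0 : ℤ))]) c.c0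

set_option maxHeartbeats 4000000 in
/-- Soundness of `(ii')` in mode `sym2` (trie-based check): on `D'`, `F ≤ -b₂₂`
(in units: `FvalG/D² ≤ -B22/(D²W)`). -/
theorem FII3S2_of_check (c : Cert3) (P : CertPolys3) {g0 g1 g2 g3 g4 q0 q1 : GramBlk}
    (hP : PolysOK3 c P g0 g1 g2 g3 g4 q0 q1) (h : checkII3S2 c P = true) (hs : checkSide3 c = true)
    (u v t : ℝ)
    (hu : -1 ≤ u) (hu' : u ≤ (c.p : ℝ) / c.q) (hv : -1 ≤ v) (hv' : v ≤ (c.p : ℝ) / c.q)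
    (ht : -1 ≤ t) (ht' : t ≤ (c.p : ℝ) / c.q)
    (hp : 0 ≤ 1 + 2 * u * v * t - u ^ 2 - v ^ 2 - t ^ 2) :
    FvalG c.n c.F u v t / 2 ^ (2 * c.S) ≤ -((c.B22 : ℝ) / c.DDW) := by
  obtain ⟨hn, hq, hpq, _, hAlen, hFk, _⟩ := side_of_check c hs
  have hu1 := abs_le_one_of_box c.p c.q hq hpq u hu hu'
  have hv1 := abs_le_one_of_box c.p c.q hq hpq v hv hv'
  have ht1 := abs_le_one_of_box c.p c.q hq hpq t ht ht'
  have hres := abs_eval_le_of_residualBound _ _ h hu1 hv1 ht1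
  rw [eval_mergeAll] at hres
  simp only [List.map_cons, List.map_nil, List.sum_cons, List.sum_nil, add_zero, eval_neg, eval_C,
    Int.cast_natCast] at hres
  have hrhs : 0 ≤ eval (rhsII3S2 c P) u v t :=
    rhsII3S2_nonneg c P hP hq hpq u v t hu hu' hv hv' ht ht' hp
  generalize hR : eval (rhsII3S2 c P) u v t = R at hres hrhs
  have htgt : 0 ≤ eval (targetII3 c P) u v t := by
    have h1 := (abs_le.1 hres).1
    linarith
  rw [targetII3, eval_neg, eval_append, eval_C, hP.hF u v t hu1 hv1 ht1,
    eval_FPolyG c.n c.d c.F hFk] at htgt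
  push_cast at htgt
  have hW : (0 : ℝ) < Wfac c.d := by exact_mod_cast Wfac_pos c.d
  have hD : (0 : ℝ) < 2 ^ (2 * c.S) := pow_pos (by norm_num) _
  have hDDW : (c.DDW : ℝ) = 2 ^ (2 * c.S) * (Wfac c.d : ℝ) := by simp [Cert3.DDW]
  have key : FvalG c.n c.F u v t * (Wfac c.d : ℝ) ≤ -(c.B22 : ℝ) := by linarith
  rw [hDDW, div_le_iff₀ hD]
  have e : -((c.B22 : ℝ) / (2 ^ (2 * c.S) * Wfac c.d)) * 2 ^ (2 * c.S) = -(c.B22 : ℝ) / Wfac c.d := by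
    field_simp
  rw [e, le_div_iff₀ hW]
  exact key

/-- **The bound from a checked certificate in Bachoc–Vallentin's own multiplier set** (mode
`sym2`), production form: trie-based residual checks `checkI3` (of `ThreePointCert.Check`) and
`checkII3S2`; otherwise as `card_le_of_cert3S2Z`. Every finite set of unit vectors of `ℝⁿ`
(`n = c.n ≥ 4`) with pairwise inner products `≤ c.p/c.q` has at most `c.N` elements. -/
theorem card_le_of_cert3S2 (c : Cert3) (P : CertPolys3) {g0 g1 g2 g3 g4 q0 q1 : GramBlk}
    (hP : PolysOK3 c P g0 g1 g2 g3 g4 q0 q1) (hI : checkI3 c P = true)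
    (hII : checkII3S2 c P = true) (hs : checkSide3 c = true) (hb : checkBound3 c P = true)
    (C : Finset (EuclideanSpace ℝ (Fin c.n))) (hC : ∀ x ∈ C, ‖x‖ = 1)
    (hcode : ∀ x ∈ C, ∀ y ∈ C, x ≠ y → inner ℝ x y ≤ (c.p : ℝ) / c.q) : C.card ≤ c.N := by
  obtain ⟨hn, hq, hpq, _, hAlen, hFk, _⟩ := side_of_check c hs
  have hbd := bound3_of_check c P hP.hF hs hb
  have hD : (0 : ℝ) < 2 ^ (2 * c.S) := pow_pos (by norm_num) _
  have hA : 0 ≤ BachocVallentin.pairSum C (fun u => AvalG c.n c.A u / 2 ^ (2 * c.S)) := by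
    have h0 := pairSum_AvalG_nonneg (by omega : 3 ≤ c.n) c.A C hC
    unfold BachocVallentin.pairSum at h0 ⊢
    have e : (∑ x ∈ C, ∑ y ∈ C, AvalG c.n c.A (inner ℝ x y) / 2 ^ (2 * c.S)) =
        (∑ x ∈ C, ∑ y ∈ C, AvalG c.n c.A (inner ℝ x y)) / 2 ^ (2 * c.S) := by
      rw [Finset.sum_div]; refine Finset.sum_congr rfl fun x _ => ?_; rw [Finset.sum_div]
    rw [e]; exact div_nonneg h0 hD.le
  have hF : 0 ≤ BachocVallentin.tripleSum C (fun u v t => FvalG c.n c.F u v t / 2 ^ (2 * c.S)) := by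
    have h0 := tripleSum_FvalG_nonneg hn c.F C hC
    unfold BachocVallentin.tripleSum at h0 ⊢
    have e : (∑ x ∈ C, ∑ y ∈ C, ∑ z ∈ C,
        FvalG c.n c.F (inner ℝ x y) (inner ℝ x z) (inner ℝ y z) / 2 ^ (2 * c.S))
        = (∑ x ∈ C, ∑ y ∈ C, ∑ z ∈ C,
          FvalG c.n c.F (inner ℝ x y) (inner ℝ x z) (inner ℝ y z)) / 2 ^ (2 * c.S) := by
      rw [Finset.sum_div]; refine Finset.sum_congr rfl fun x _ => ?_
      rw [Finset.sum_div]; refine Finset.sum_congr rfl fun y _ => ?_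
      rw [Finset.sum_div]
    rw [e]; exact div_nonneg h0 hD.le
  have h := BachocVallentin.card_le_of_threePoint ((c.p : ℝ) / c.q) C hC hcode
    (fun u => AvalG c.n c.A u / 2 ^ (2 * c.S)) (fun u v t => FvalG c.n c.F u v t / 2 ^ (2 * c.S))
    ((c.B11 : ℝ) / c.DDW) ((c.B12 : ℝ) / c.DDW) ((c.B22 : ℝ) / c.DDW) hA hF
    (fun u v t => by rw [FvalG_swap12])
    (fun u v t => by rw [FvalG_swap23])
    (bquad3_nonneg_of_check c hs)
    (fun u hu hu' => AF3_of_check c P hP hI hs u hu hu')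
    (fun u v t hu hu' hv hv' ht ht' hp =>
      FII3S2_of_check c P hP hII hs u v t hu hu' hv hv' ht ht' hp)
    hbd.2
  have hlt : (C.card : ℝ) < (c.N : ℝ) + 1 := lt_of_le_of_lt h hbd.1
  have hlt' : C.card < c.N + 1 := by exact_mod_cast hlt
  omega

end Summit.Ventures.PackingBounds.ThreePointCert

end
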